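import Summits.QuantumAdvantage.QuantumAdvantage.Theorems.SosSandwichTransferPBPathBoundChain
import HarnessLib

/-!
# `TransferPB`'s machine reduction per family AT THE MACHINE'S OWN SCALE, part 1 — towards the UNCONDITIONAL log-query transfer

Route `SosSandwich`; support for `RandomOracleHeurSeparation` (stmt-QuantumAdvantage-1131) and the analytic crux (stmt-15237);
target: RandomOracleGauge's support item `LogQueryTransfer` (stmt-QuantumAdvantage-1155) — Aaronson–Ambainis Thm. 26
(`BQP^{A[log]} ⊆ AvgP^A` a.s.) in the promise-transfer form, with NO influence conjecture.  The per-family chain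
(`…TransferPBPerFamily*.lean`) still asks for an influence bound `C₀ (ε/d)^c` at EVERY scale `ε`, which the proved DFKO bound
(`2^{-O(d)}` loss) cannot supply once `d ~ log n`.  But the root machine only uses the bound at ITS OWN scale
`ε = θ/2 = 1/(400 (r(n)+1))`, which is `1/poly(n)` once the error polynomial is bumped (`r' = r + X`): there the slack `ε^{c-a}`
absorbs `2^{O(log n)} = poly(n)`.  So this file re-states the nine levels (proofs verbatim twins; root: `intro F` dropped, the
machine instantiated at the bumped `r'`, final bound `1/(r'(n)+1) ≤ 1/(r(n)+1)`) with the hypothesis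

  `ScaleBound F₀ := ∀ r, ∃ r' c k, r ≤ r' ∧ ∀ x (|x| ≥ 1) ρ, θ'_x/2 < Var[p_x|_ρ] → ∃ i, 2^{-k} ((θ'_x/2)/thm23Degree F₀ x)^c ≤ Inf_i`,
  `θ'_x = (1/10)² · (1/(r'(|x|)+1)) / 2` (written out inline),

and the sequel proves `ScaleBound F₀` UNCONDITIONALLY for every uniform family with `≤ c'·log₂ n + c'` oracle gates.
Honest label: re-threading + one new arithmetic lemma; nothing new about machines.
Sources: AaronsonAmbainis2014 Thm. 21, 23 (proof p. 14), 26; DinurEtAl2007 Thm. 3; Zhandry2012; BBBV1997.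
-/

-- D-0017: single-conjunct summit ⇒ the duplicate `QuantumAdvantage.QuantumAdvantage` is mandated.
set_option linter.dupNamespace false

noncomputable section

namespace Summit.QuantumAdvantage.QuantumAdvantage.Cruxes.TransferPB.Birth

open Finset MeasureTheory Literature.Computability.Cryptography Literature.Computability.Complexity
  Literature.Computability.QuantumComplexity Literature.Computability.QuantumComplexity.ClassicalSimulation
open Summit.QuantumAdvantage.QuantumAdvantage.Theses.SosSandwich
open scoped ENNReal

namespace SimTreePB


/-- **Live root of the machine reduction with the PATH-WISE influence bound** (twin of `oracleSimulation_of_potentialMachines`: same machine hypothesis — potential-driven advisor — and same proof; `PseudoBoundedAA` and stub 1 are replaced by the influence bound along the restriction paths of `p_x`, which is all that `complete_of_pb` was used for). [cite: AaronsonAmbainis2014, Thm. 23 (proof, p. 14)] Per-family form. -/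
theorem oracleSimulationSc_of_potentialMachines_path (F₀ : QCircuitFamily cliffordT)
    (hmach : ∀ (c k : ℕ) (F : QCircuitFamily cliffordT), F.IsUniform → ∀ r : Polynomial ℕ,
      ∃ Q ∈ Literature.Computability.Cryptography.PromiseBQP, ∃ (C : OracleAlg Bool) (q : Polynomial ℕ),
        C.IsPolyTime Computability.encodingBoolBool ∧
        (∀ (O : Oracle) (x : List Bool), ∀ y ∈ C.queries O (q.eval x.length) x, y.length ≤ q.eval x.length) ∧
        ∀ x : List Bool, 1 ≤ x.length → ∀ g : List Bool → Bool,
          (∀ v ∈ Q.yes, g v = true) → (∀ v ∈ Q.no, g v = false) →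
          ∃ (Adv : Advisor (numOracleBits F x)) (Φ : List (Fin (numOracleBits F x) × Bool) → ℝ) (τ : ℝ) (D : ℕ),
            0 < τ ∧ 0 < D ∧ 2 * Φ [] / (τ * (1 / (((r.eval x.length : ℕ) : ℝ) + 1))) ≤ D ∧
            (∀ (ρ : List (Fin (numOracleBits F x) × Bool)) (i : Fin (numOracleBits F x)),
              Adv.pick ρ = some i → i ∉ ρ.map Prod.fst) ∧
            (∀ ρ : List (Fin (numOracleBits F x) × Bool), 0 ≤ Φ ρ) ∧
            (∀ (ρ : List (Fin (numOracleBits F x) × Bool)) (i : Fin (numOracleBits F x)), Adv.pick ρ = some i →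
              Φ (ρ ++ [(i, false)]) + Φ (ρ ++ [(i, true)]) + 2 * τ ≤ 2 * Φ ρ) ∧
            (∀ ρ : List (Fin (numOracleBits F x) × Bool), Adv.pick ρ = none → ∀ i : Fin (numOracleBits F x),
              influence i (restrictPath ρ (acceptPoly F x)) <
                (1 / 2 ^ k : ℝ) * ((((1 / 10 : ℝ) ^ 2 * (1 / (((r.eval x.length : ℕ) : ℝ) + 1)) / 2) / 2) /
                    thm23Degree F x) ^ c) ∧
            (∀ ρ : List (Fin (numOracleBits F x) × Bool),
              |Adv.val ρ - boolAvg (evalBool (restrictPath ρ (acceptPoly F x)))| ≤ 1 / 20) ∧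
            ∀ A : Set (List Bool),
              C.run (Oracle.ofLanguage {w : List Bool | ∃ v : List Bool,
                  (w = false :: v ∧ v ∈ A) ∨ (w = true :: v ∧ g v = true)}) (q.eval x.length) x =
                some (decide (1 / 2 ≤ (advTree Adv D []).eval (oracleBits F x A)))) :
    (∀ r : Polynomial ℕ, ∃ (r' : Polynomial ℕ) (c k : ℕ), (∀ n, r.eval n ≤ r'.eval n) ∧
      ∀ (x : List Bool), 1 ≤ x.length → ∀ ρ : List (Fin (numOracleBits F₀ x) × Bool),
        ((1 / 10 : ℝ) ^ 2 * (1 / (((r'.eval x.length : ℕ) : ℝ) + 1)) / 2) / 2 <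
            boolVariance (restrictPath ρ (acceptPoly F₀ x)) →
          ∃ i : Fin (numOracleBits F₀ x),
            (1 / 2 ^ k : ℝ) * ((((1 / 10 : ℝ) ^ 2 * (1 / (((r'.eval x.length : ℕ) : ℝ) + 1)) / 2) / 2) /
              thm23Degree F₀ x) ^ c ≤ influence i (restrictPath ρ (acceptPoly F₀ x))) →
      F₀.IsUniform → ∀ r : Polynomial ℕ,
        ∃ Q ∈ Literature.Computability.Cryptography.PromiseBQP, ∃ (C : OracleAlg Bool) (q : Polynomial ℕ),
          C.IsPolyTime Computability.encodingBoolBool ∧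
          (∀ (O : Oracle) (x : List Bool), ∀ y ∈ C.queries O (q.eval x.length) x, y.length ≤ q.eval x.length) ∧
          ∀ x : List Bool, 1 ≤ x.length → ∀ g : List Bool → Bool,
            (∀ v ∈ Q.yes, g v = true) → (∀ v ∈ Q.no, g v = false) →
            (ProbabilityTheory.setBernoulli (Set.univ : Set (List Bool)) ⟨1 / 2, by norm_num, by norm_num⟩)
              {A : Set (List Bool) |
                (2 / 3 ≤ F₀.acceptProbOn A x ∧
                  C.run (Oracle.ofLanguage {w : List Bool | ∃ v : List Bool, (w = false :: v ∧ v ∈ A) ∨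
                    (w = true :: v ∧ g v = true)}) (q.eval x.length) x ≠ some true) ∨
                (F₀.acceptProbOn A x ≤ 1 / 3 ∧
                  C.run (Oracle.ofLanguage {w : List Bool | ∃ v : List Bool, (w = false :: v ∧ v ∈ A) ∨
                    (w = true :: v ∧ g v = true)}) (q.eval x.length) x ≠ some false)}
              ≤ ENNReal.ofReal (1 / (((r.eval x.length : ℕ) : ℝ) + 1)) := by
  intro hAA hF r
  obtain ⟨r', c, k, hrr', HAA⟩ := hAA r
  obtain ⟨Q, hQ, C, q, hCpoly, hCq, hC⟩ := hmach c k F₀ hF r'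
  refine ⟨Q, hQ, C, q, hCpoly, hCq, fun x hx g hgy hgn => ?_⟩
  obtain ⟨Adv, Φ, τ, D, hτ, hD0, hD, hfresh, hΦ0, hdrop, hnone, hval, hrun⟩ := hC x hx g hgy hgn
  -- parameters (at the bumped error polynomial `r'`)
  have hcomplete := HAA x hx
  set δ : ℝ := 1 / (((r'.eval x.length : ℕ) : ℝ) + 1) with hδ
  have hδpos : 0 < δ := by positivity
  have hε : (0 : ℝ) < 1 / 10 := by norm_num
  have hd1 : 1 ≤ thm23Degree F₀ x := by unfold thm23Degree; omega
  set θ : ℝ := (1 / 10 : ℝ) ^ 2 * δ / 2 with hθ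
  have hθpos : 0 < θ := by positivity
  -- refusals certify small variance (all influences `< w` + completeness)
  have hnone' : ∀ ρ : List (Fin (numOracleBits F₀ x) × Bool), Adv.pick ρ = none →
      boolVariance (restrictPath ρ (acceptPoly F₀ x)) ≤ (1 / 10 : ℝ) ^ 2 * δ / 2 := by
    intro ρ hρ
    rw [← hθ]
    by_contra hbig
    have hbig' : θ / 2 < boolVariance (restrictPath ρ (acceptPoly F₀ x)) := by
      have : θ / 2 ≤ θ := by linarith
      exact lt_of_le_of_lt this (not_le.1 hbig)
    obtain ⟨i, hi⟩ := hcomplete ρ hbig'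
    exact absurd (hnone ρ hρ i) (not_lt.2 hi)
  have hdev := measure_advTree_acceptPoly_deviation_le_pot F₀ x hε hδpos hτ hfresh hΦ0 hdrop hnone' hval hD0 hD
  have hsub := threshold_subset_deviation F₀ x (advTree Adv D []) (ε := 1 / 10) (η := 1 / 20) (by norm_num)
  have hset : {A : Set (List Bool) |
      (2 / 3 ≤ F₀.acceptProbOn A x ∧
        C.run (Oracle.ofLanguage {w : List Bool | ∃ v : List Bool,
            (w = false :: v ∧ v ∈ A) ∨ (w = true :: v ∧ g v = true)}) (q.eval x.length) x ≠ some true) ∨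
      (F₀.acceptProbOn A x ≤ 1 / 3 ∧
        C.run (Oracle.ofLanguage {w : List Bool | ∃ v : List Bool,
            (w = false :: v ∧ v ∈ A) ∨ (w = true :: v ∧ g v = true)}) (q.eval x.length) x ≠ some false)} =
      {A : Set (List Bool) |
        (2 / 3 ≤ F₀.acceptProbOn A x ∧ decide (1 / 2 ≤ (advTree Adv D []).eval (oracleBits F₀ x A)) ≠ true) ∨
          (F₀.acceptProbOn A x ≤ 1 / 3 ∧
            decide (1 / 2 ≤ (advTree Adv D []).eval (oracleBits F₀ x A)) ≠ false)} := by
    ext A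
    simp only [Set.mem_setOf_eq, hrun A, ne_eq, Option.some.injEq]
  have hδle : ENNReal.ofReal δ ≤ ENNReal.ofReal (1 / (((r.eval x.length : ℕ) : ℝ) + 1)) := by
    apply ENNReal.ofReal_le_ofReal
    rw [hδ]
    apply one_div_le_one_div_of_le (by positivity)
    have := hrr' x.length
    exact_mod_cast Nat.add_le_add_right this 1
  show (ProbabilityTheory.setBernoulli (Set.univ : Set (List Bool)) ⟨1 / 2, by norm_num, by norm_num⟩) _ ≤ _
  change randomOracleMeasure _ ≤ _
  rw [hset]
  exact ((measure_mono hsub).trans hdev).trans hδle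

/-- **Magnitude-machine level, path-wise bound** (twin of `oracleSimulation_of_magnitudeMachines`, per-family form, proof verbatim over the path-wise root). [cite: AaronsonAmbainis2014, Thm. 23 (proof, p. 14)] -/

theorem oracleSimulationSc_of_magnitudeMachines_path (F₀ : QCircuitFamily cliffordT)
    (hmach : ∀ (c k : ℕ) (F : QCircuitFamily cliffordT), F.IsUniform → ∀ r : Polynomial ℕ,
      ∃ Q ∈ Literature.Computability.Cryptography.PromiseBQP, ∃ (C : OracleAlg Bool) (q : Polynomial ℕ),
        C.IsPolyTime Computability.encodingBoolBool ∧
        (∀ (O : Oracle) (x : List Bool), ∀ y ∈ C.queries O (q.eval x.length) x, y.length ≤ q.eval x.length) ∧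
        ∀ x : List Bool, 1 ≤ x.length → ∀ g : List Bool → Bool,
          (∀ v ∈ Q.yes, g v = true) → (∀ v ∈ Q.no, g v = false) →
          ∃ (Adv : Advisor (numOracleBits F x))
            (f : Fin (numOracleBits F x) → (Fin (numOracleBits F x) → Bool) → ℝ) (τ : ℝ) (D : ℕ),
            0 < τ ∧ 0 < D ∧
            2 * (∑ s, boolAvg (f s)) / (τ * (1 / (((r.eval x.length : ℕ) : ℝ) + 1))) ≤ D ∧
            (∀ s y, 0 ≤ f s y) ∧
            (∀ (ρ : List (Fin (numOracleBits F x) × Bool)) (i : Fin (numOracleBits F x)),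
              Adv.pick ρ = some i → i ∉ ρ.map Prod.fst ∧
                τ ≤ boolAvg (fun y => f i (ρ.foldr (fun ib z => Function.update z ib.1 ib.2) y))) ∧
            (∀ ρ : List (Fin (numOracleBits F x) × Bool), Adv.pick ρ = none → ∀ i : Fin (numOracleBits F x),
              influence i (restrictPath ρ (acceptPoly F x)) <
                (1 / 2 ^ k : ℝ) * ((((1 / 10 : ℝ) ^ 2 * (1 / (((r.eval x.length : ℕ) : ℝ) + 1)) / 2) / 2) /
                    thm23Degree F x) ^ c) ∧
            (∀ ρ : List (Fin (numOracleBits F x) × Bool),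
              |Adv.val ρ - boolAvg (evalBool (restrictPath ρ (acceptPoly F x)))| ≤ 1 / 20) ∧
            ∀ A : Set (List Bool),
              C.run (Oracle.ofLanguage {w : List Bool | ∃ v : List Bool,
                  (w = false :: v ∧ v ∈ A) ∨ (w = true :: v ∧ g v = true)}) (q.eval x.length) x =
                some (decide (1 / 2 ≤ (advTree Adv D []).eval (oracleBits F x A)))) :
    (∀ r : Polynomial ℕ, ∃ (r' : Polynomial ℕ) (c k : ℕ), (∀ n, r.eval n ≤ r'.eval n) ∧
      ∀ (x : List Bool), 1 ≤ x.length → ∀ ρ : List (Fin (numOracleBits F₀ x) × Bool),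
        ((1 / 10 : ℝ) ^ 2 * (1 / (((r'.eval x.length : ℕ) : ℝ) + 1)) / 2) / 2 <
            boolVariance (restrictPath ρ (acceptPoly F₀ x)) →
          ∃ i : Fin (numOracleBits F₀ x),
            (1 / 2 ^ k : ℝ) * ((((1 / 10 : ℝ) ^ 2 * (1 / (((r'.eval x.length : ℕ) : ℝ) + 1)) / 2) / 2) /
              thm23Degree F₀ x) ^ c ≤ influence i (restrictPath ρ (acceptPoly F₀ x))) →
      F₀.IsUniform → ∀ r : Polynomial ℕ,
        ∃ Q ∈ Literature.Computability.Cryptography.PromiseBQP, ∃ (C : OracleAlg Bool) (q : Polynomial ℕ),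
          C.IsPolyTime Computability.encodingBoolBool ∧
          (∀ (O : Oracle) (x : List Bool), ∀ y ∈ C.queries O (q.eval x.length) x, y.length ≤ q.eval x.length) ∧
          ∀ x : List Bool, 1 ≤ x.length → ∀ g : List Bool → Bool,
            (∀ v ∈ Q.yes, g v = true) → (∀ v ∈ Q.no, g v = false) →
            (ProbabilityTheory.setBernoulli (Set.univ : Set (List Bool)) ⟨1 / 2, by norm_num, by norm_num⟩)
              {A : Set (List Bool) |
                (2 / 3 ≤ F₀.acceptProbOn A x ∧
                  C.run (Oracle.ofLanguage {w : List Bool | ∃ v : List Bool, (w = false :: v ∧ v ∈ A) ∨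
                    (w = true :: v ∧ g v = true)}) (q.eval x.length) x ≠ some true) ∨
                (F₀.acceptProbOn A x ≤ 1 / 3 ∧
                  C.run (Oracle.ofLanguage {w : List Bool | ∃ v : List Bool, (w = false :: v ∧ v ∈ A) ∨
                    (w = true :: v ∧ g v = true)}) (q.eval x.length) x ≠ some false)}
              ≤ ENNReal.ofReal (1 / (((r.eval x.length : ℕ) : ℝ) + 1)) := by
  refine oracleSimulationSc_of_potentialMachines_path F₀ fun c k F hF r => ?_
  obtain ⟨Q, hQ, C, q, hCpoly, hCq, hC⟩ := hmach c k F hF r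
  refine ⟨Q, hQ, C, q, hCpoly, hCq, fun x hx g hgy hgn => ?_⟩
  obtain ⟨Adv, f, τ, D, hτ, hD0, hD, hf0, hpick, hnone, hval, hrun⟩ := hC x hx g hgy hgn
  -- the averaged free-bit potential
  let Φ : List (Fin (numOracleBits F x) × Bool) → ℝ := fun ρ =>
    ∑ s ∈ univ.filter (fun s => s ∉ ρ.map Prod.fst),
      boolAvg (fun y => f s (ρ.foldr (fun ib z => Function.update z ib.1 ib.2) y))
  have hfilt : (univ.filter fun s : Fin (numOracleBits F x) =>
      s ∉ ([] : List (Fin (numOracleBits F x) × Bool)).map Prod.fst) = univ :=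
    Finset.filter_true_of_mem fun s _ => by simp
  have hΦnil : Φ [] = ∑ s, boolAvg (f s) := by
    show (∑ s ∈ univ.filter (fun s => s ∉ ([] : List (Fin (numOracleBits F x) × Bool)).map Prod.fst),
      boolAvg (fun y => f s (([] : List (Fin (numOracleBits F x) × Bool)).foldr
        (fun ib z => Function.update z ib.1 ib.2) y))) = _
    rw [hfilt]
    rfl
  refine ⟨Adv, Φ, τ, D, hτ, hD0, by rw [hΦnil]; exact hD, fun ρ i h => (hpick ρ i h).1, fun ρ => ?_,
    fun ρ i h => ?_, hnone, hval, hrun⟩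
  · exact Finset.sum_nonneg fun s _ => boolAvg_nonneg fun y => hf0 s _
  · obtain ⟨hfresh, hτle⟩ := hpick ρ i h
    have hsplit := freeSum_avgOverride_split f ρ i hfresh
    simp only [Φ]
    linarith

/-- **BBBV-machine level, path-wise bound** (twin of `oracleSimulation_of_bbbvMachines`, per-family form, proof verbatim). [cite: AaronsonAmbainis2014, Thm. 23 (proof, p. 14)] [cite: BennettBernsteinBrassardVazirani1997, Thm. 3.3] -/

theorem oracleSimulationSc_of_bbbvMachines_path (F₀ : QCircuitFamily cliffordT)
    (hmach : ∀ (c k : ℕ) (F : QCircuitFamily cliffordT), F.IsUniform → ∀ r : Polynomial ℕ,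
      ∃ Q ∈ Literature.Computability.Cryptography.PromiseBQP, ∃ (C : OracleAlg Bool) (q : Polynomial ℕ),
        C.IsPolyTime Computability.encodingBoolBool ∧
        (∀ (O : Oracle) (x : List Bool), ∀ y ∈ C.queries O (q.eval x.length) x, y.length ≤ q.eval x.length) ∧
        ∀ x : List Bool, 1 ≤ x.length → ∀ g : List Bool → Bool,
          (∀ v ∈ Q.yes, g v = true) → (∀ v ∈ Q.no, g v = false) →
          ∃ (Adv : Advisor (numOracleBits F x)) (τ : ℝ) (D : ℕ),
            0 < τ ∧ 0 < D ∧
            8 * ((F.circ x.length).oracleQueries : ℝ) ^ 2 / (τ * (1 / (((r.eval x.length : ℕ) : ℝ) + 1))) ≤ D ∧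
            (∀ (ρ : List (Fin (numOracleBits F x) × Bool)) (i : Fin (numOracleBits F x)),
              Adv.pick ρ = some i → i ∉ ρ.map Prod.fst ∧
                τ ≤ boolAvg (fun y => 4 * ((F.circ x.length).oracleQueries : ℝ) *
                  (queryWeights (oracleOf F x (ρ.foldr (fun ib z => Function.update z ib.1 ib.2) y))
                    ({((bitEquiv F x).symm i).1} : Set (List Bool)) (F.circ x.length).gates
                    (basisState (padInput x.get (F.ancillas x.length)))).sum)) ∧
            (∀ ρ : List (Fin (numOracleBits F x) × Bool), Adv.pick ρ = none → ∀ i : Fin (numOracleBits F x),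
              i ∉ ρ.map Prod.fst →
                boolAvg (fun y => 4 * ((F.circ x.length).oracleQueries : ℝ) *
                  (queryWeights (oracleOf F x (ρ.foldr (fun ib z => Function.update z ib.1 ib.2) y))
                    ({((bitEquiv F x).symm i).1} : Set (List Bool)) (F.circ x.length).gates
                    (basisState (padInput x.get (F.ancillas x.length)))).sum) <
                (1 / 2 ^ k : ℝ) * ((((1 / 10 : ℝ) ^ 2 * (1 / (((r.eval x.length : ℕ) : ℝ) + 1)) / 2) / 2) /
                    thm23Degree F x) ^ c) ∧
            (∀ ρ : List (Fin (numOracleBits F x) × Bool),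
              |Adv.val ρ - boolAvg (evalBool (restrictPath ρ (acceptPoly F x)))| ≤ 1 / 20) ∧
            ∀ A : Set (List Bool),
              C.run (Oracle.ofLanguage {w : List Bool | ∃ v : List Bool,
                  (w = false :: v ∧ v ∈ A) ∨ (w = true :: v ∧ g v = true)}) (q.eval x.length) x =
                some (decide (1 / 2 ≤ (advTree Adv D []).eval (oracleBits F x A)))) :
    (∀ r : Polynomial ℕ, ∃ (r' : Polynomial ℕ) (c k : ℕ), (∀ n, r.eval n ≤ r'.eval n) ∧
      ∀ (x : List Bool), 1 ≤ x.length → ∀ ρ : List (Fin (numOracleBits F₀ x) × Bool),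
        ((1 / 10 : ℝ) ^ 2 * (1 / (((r'.eval x.length : ℕ) : ℝ) + 1)) / 2) / 2 <
            boolVariance (restrictPath ρ (acceptPoly F₀ x)) →
          ∃ i : Fin (numOracleBits F₀ x),
            (1 / 2 ^ k : ℝ) * ((((1 / 10 : ℝ) ^ 2 * (1 / (((r'.eval x.length : ℕ) : ℝ) + 1)) / 2) / 2) /
              thm23Degree F₀ x) ^ c ≤ influence i (restrictPath ρ (acceptPoly F₀ x))) →
      F₀.IsUniform → ∀ r : Polynomial ℕ,
        ∃ Q ∈ Literature.Computability.Cryptography.PromiseBQP, ∃ (C : OracleAlg Bool) (q : Polynomial ℕ),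
          C.IsPolyTime Computability.encodingBoolBool ∧
          (∀ (O : Oracle) (x : List Bool), ∀ y ∈ C.queries O (q.eval x.length) x, y.length ≤ q.eval x.length) ∧
          ∀ x : List Bool, 1 ≤ x.length → ∀ g : List Bool → Bool,
            (∀ v ∈ Q.yes, g v = true) → (∀ v ∈ Q.no, g v = false) →
            (ProbabilityTheory.setBernoulli (Set.univ : Set (List Bool)) ⟨1 / 2, by norm_num, by norm_num⟩)
              {A : Set (List Bool) |
                (2 / 3 ≤ F₀.acceptProbOn A x ∧
                  C.run (Oracle.ofLanguage {w : List Bool | ∃ v : List Bool, (w = false :: v ∧ v ∈ A) ∨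
                    (w = true :: v ∧ g v = true)}) (q.eval x.length) x ≠ some true) ∨
                (F₀.acceptProbOn A x ≤ 1 / 3 ∧
                  C.run (Oracle.ofLanguage {w : List Bool | ∃ v : List Bool, (w = false :: v ∧ v ∈ A) ∨
                    (w = true :: v ∧ g v = true)}) (q.eval x.length) x ≠ some false)}
              ≤ ENNReal.ofReal (1 / (((r.eval x.length : ℕ) : ℝ) + 1)) := by
  refine oracleSimulationSc_of_magnitudeMachines_path F₀ fun c k F hF r => ?_
  obtain ⟨Q, hQ, C, q, hCpoly, hCq, hC⟩ := hmach c k F hF r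
  refine ⟨Q, hQ, C, q, hCpoly, hCq, fun x hx g hgy hgn => ?_⟩
  obtain ⟨Adv, τ, D, hτ, hD0, hD, hpick, hnone, hval, hrun⟩ := hC x hx g hgy hgn
  -- the BBBV weight
  let f : Fin (numOracleBits F x) → (Fin (numOracleBits F x) → Bool) → ℝ := fun s b =>
    4 * ((F.circ x.length).oracleQueries : ℝ) *
      (queryWeights (oracleOf F x b) ({((bitEquiv F x).symm s).1} : Set (List Bool)) (F.circ x.length).gates
        (basisState (padInput x.get (F.ancillas x.length)))).sum
  have hf0 : ∀ s b, 0 ≤ f s b := fun s b =>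
    mul_nonneg (by positivity) (List.sum_nonneg (queryWeights_nonneg _ _ _ _))
  have hsum : ∑ s, boolAvg (f s) ≤ 4 * ((F.circ x.length).oracleQueries : ℝ) ^ 2 :=
    sum_boolAvg_bbbvWeight_le F x cliffordT_isUnitary_holds
  set δ : ℝ := 1 / (((r.eval x.length : ℕ) : ℝ) + 1) with hδ
  have hδpos : 0 < δ := by positivity
  have hwpos : (0 : ℝ) < (1 / 2 ^ k : ℝ) * ((((1 / 10 : ℝ) ^ 2 * δ / 2) / 2) / thm23Degree F x) ^ c := by
    have hd : (0 : ℝ) < thm23Degree F x := by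
      have : 1 ≤ thm23Degree F x := by unfold thm23Degree; omega
      exact_mod_cast this
    positivity
  refine ⟨Adv, f, τ, D, hτ, hD0, ?_, hf0, hpick, fun ρ hρ i => ?_, hval, hrun⟩
  · -- budget: `2 (Σ_s E f_s)/(τδ) ≤ 8T²/(τδ) ≤ D`
    refine le_trans ?_ hD
    rw [div_le_div_iff_of_pos_right (by positivity)]
    linarith
  · -- refusal: free bits by BBBV + the magnitude clause, revealed bits have influence `0`
    by_cases hi : i ∈ ρ.map Prod.fst
    · rw [influence_restrictPath_eq_zero_of_mem i ρ (acceptPoly F x) hi]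
      exact hwpos
    · exact (influence_restrictPath_acceptPoly_le F x cliffordT_isUnitary_holds ρ i hi).trans_lt (hnone ρ hρ i hi)


/-- **Kept-machine level, path-wise bound** (twin of `stub_pbOracleSimulation_of_keptMachines`, per-family form, proof verbatim). [cite: AaronsonAmbainis2014, Thm. 23 (proof, p. 14)] -/
theorem oracleSimulationSc_of_keptMachines_path (F₀ : QCircuitFamily cliffordT)
    (hQ : ∀ (c k : ℕ) (F : QCircuitFamily cliffordT), F.IsUniform → ∀ r : Polynomial ℕ,
      nodeProblem F r c k ∈ Literature.Computability.Cryptography.PromiseBQP)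
    (hM : ∀ (c k : ℕ) (F : QCircuitFamily cliffordT), F.IsUniform → ∀ r : Polynomial ℕ,
      ∃ (C : OracleAlg Bool) (q : Polynomial ℕ),
        C.IsPolyTime Computability.encodingBoolBool ∧
        (∀ (O : Oracle) (x : List Bool), ∀ y ∈ C.queries O (q.eval x.length) x, y.length ≤ q.eval x.length) ∧
        ∀ x : List Bool, 1 ≤ x.length → ∀ g : List Bool → Bool,
          (∀ v ∈ (nodeProblem F r c k).yes, g v = true) → (∀ v ∈ (nodeProblem F r c k).no, g v = false) →
          ∃ (Adv : Advisor (numOracleBits F x)) (D : ℕ),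
            machineBudget F x r c k ≤ D ∧
            (∀ (ρ : List (Fin (numOracleBits F x) × Bool)) (s : Fin (numOracleBits F x)),
              Adv.pick ρ = some s → s ∉ ρ.map Prod.fst ∧ g (encSingle F x ρ s) = true) ∧
            (∀ ρ : List (Fin (numOracleBits F x) × Bool), Adv.pick ρ = none →
              ∀ s : Fin (numOracleBits F x), s ∉ ρ.map Prod.fst → ¬ Kept F x g ρ s) ∧
            (∀ ρ : List (Fin (numOracleBits F x) × Bool),
              Adv.val ρ = (((Icc 1 40).filter fun j => g (encMean F x ρ j) = true).card : ℝ) / 40) ∧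
            ∀ A : Set (List Bool),
              C.run (Oracle.ofLanguage {w : List Bool | ∃ v : List Bool,
                  (w = false :: v ∧ v ∈ A) ∨ (w = true :: v ∧ g v = true)}) (q.eval x.length) x =
                some (decide (1 / 2 ≤ (advTree Adv D []).eval (oracleBits F x A)))) :
    (∀ r : Polynomial ℕ, ∃ (r' : Polynomial ℕ) (c k : ℕ), (∀ n, r.eval n ≤ r'.eval n) ∧
      ∀ (x : List Bool), 1 ≤ x.length → ∀ ρ : List (Fin (numOracleBits F₀ x) × Bool),
        ((1 / 10 : ℝ) ^ 2 * (1 / (((r'.eval x.length : ℕ) : ℝ) + 1)) / 2) / 2 <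
            boolVariance (restrictPath ρ (acceptPoly F₀ x)) →
          ∃ i : Fin (numOracleBits F₀ x),
            (1 / 2 ^ k : ℝ) * ((((1 / 10 : ℝ) ^ 2 * (1 / (((r'.eval x.length : ℕ) : ℝ) + 1)) / 2) / 2) /
              thm23Degree F₀ x) ^ c ≤ influence i (restrictPath ρ (acceptPoly F₀ x))) →
      F₀.IsUniform → ∀ r : Polynomial ℕ,
        ∃ Q ∈ Literature.Computability.Cryptography.PromiseBQP, ∃ (C : OracleAlg Bool) (q : Polynomial ℕ),
          C.IsPolyTime Computability.encodingBoolBool ∧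
          (∀ (O : Oracle) (x : List Bool), ∀ y ∈ C.queries O (q.eval x.length) x, y.length ≤ q.eval x.length) ∧
          ∀ x : List Bool, 1 ≤ x.length → ∀ g : List Bool → Bool,
            (∀ v ∈ Q.yes, g v = true) → (∀ v ∈ Q.no, g v = false) →
            (ProbabilityTheory.setBernoulli (Set.univ : Set (List Bool)) ⟨1 / 2, by norm_num, by norm_num⟩)
              {A : Set (List Bool) |
                (2 / 3 ≤ F₀.acceptProbOn A x ∧
                  C.run (Oracle.ofLanguage {w : List Bool | ∃ v : List Bool, (w = false :: v ∧ v ∈ A) ∨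
                    (w = true :: v ∧ g v = true)}) (q.eval x.length) x ≠ some true) ∨
                (F₀.acceptProbOn A x ≤ 1 / 3 ∧
                  C.run (Oracle.ofLanguage {w : List Bool | ∃ v : List Bool, (w = false :: v ∧ v ∈ A) ∨
                    (w = true :: v ∧ g v = true)}) (q.eval x.length) x ≠ some false)}
              ≤ ENNReal.ofReal (1 / (((r.eval x.length : ℕ) : ℝ) + 1)) := by
  refine oracleSimulationSc_of_bbbvMachines_path F₀ fun c k F hF r => ?_
  obtain ⟨C, q, hCpoly, hCq, hrun⟩ := hM c k F hF r
  refine ⟨nodeProblem F r c k, hQ c k F hF r, C, q, hCpoly, hCq, fun x hx g hgy hgn => ?_⟩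
  obtain ⟨Adv, D, hD, hpick, hnone, hval, hrunA⟩ := hrun x hx g hgy hgn
  refine ⟨Adv, pbThreshold F x r c k / 2, D, half_pos (pbThreshold_pos F x r c k),
    lt_of_lt_of_le machineBudget_pos hD, ?_, ?_, ?_, ?_, hrunA⟩
  · -- budget
    exact budgetBound_le_machineBudget.trans (by exact_mod_cast hD)
  · -- picks: free, magnitude ≥ w/2
    intro ρ i h
    obtain ⟨hfree, hsingle⟩ := hpick ρ i h
    exact ⟨hfree, halfThreshold_le_bbbvMag_of_single hgn hsingle⟩
  · -- refusals: every free magnitude < w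
    intro ρ h i hi
    exact bbbvMag_lt_of_not_kept hgy (hnone ρ h i hi)
  · -- values
    intro ρ
    rw [hval ρ]
    exact countVal_accurate hgy hgn ρ



end SimTreePB

end Summit.QuantumAdvantage.QuantumAdvantage.Cruxes.TransferPB.Birth

end
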